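import Summits.BirchSwinnertonDyer.BirchSwinnertonDyer.Theorems.GenusKolyvaginAtTwoPowDvdShaCardAtTwoRTGenusRestrictionDvd
import Summits.BirchSwinnertonDyer.BirchSwinnertonDyer.Theorems.GenusKolyvaginAtTwoCasselsTateNumberField
import Summits.BirchSwinnertonDyer.BirchSwinnertonDyer.Theorems.GenusKolyvaginAtTwoShaCardDvdPowAtTwoPosTOnCut
import Summits.BirchSwinnertonDyer.BirchSwinnertonDyer.Theorems.GenusKolyvaginAtTwoGenusPrimitiveSupplyAtTwoPosDiscShallowKFourPosSelmerCountCurrency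
import HarnessLib

/-!
# Route `GenusKolyvaginAtTwo`, residual `OffCutResidualAtTwoR` (stmt-BirchSwinnertonDyer-31767), LINE 27 «socle_selection» / LINE 28
# «visible_deep_socle» (bsd-idea-1 g25) — THE LOWER COUNT TRANSFER K/ℚ `2^(2m) ∣ #Ш(E/ℚ)[2^∞] ⟹ 2^(2m) ∣ #Ш(E_K/K)[2^∞]` AND THE
# DEPTH-ONE LOWER COUNT `4 ∣ #Ш(E_K/K)[2^∞]`: the stubs S6L / N6 («the bet») at `M₀ ≤ 1`, and their reduction to the ℚ-side

Seat `bsd-line-gk2-p4` g30 (cell `bsd-f1-sign2`), WIDTH-5 attach on route `GenusKolyvaginAtTwo` rev 59; lineage `ShaCores` (g27–g29: one-bit law,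
cor-compatibility, the `hRC`-free consistency law).  `--supports stmt-BirchSwinnertonDyer-31767 --as helper`.  THEOREMS ONLY (no definition, no
named fact, no `sorry`); standard axioms.  **BSD is NOT proved by this file; `OffCutResidualAtTwoR` is NOT proved; nothing is closed.**

WHAT.  After LEAD gk2-p1 g24's `SocleSelection.upperCountTransfer` (p774844: the K/ℚ transfer of the UPPER count), LINE 27 v1.8 has three
`sorry`s (S2, S6L, S7) and LINE 28 v1.9 four (N1, N2, N6, N7); S6L / N6 ask for the LOWER count `4^(M₀) ∣ #Ш(E_K/K)[2^∞]` off the cut.  This file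
is the twin of p774844 for the lower count (pen bsd-idea-1 g25 HANDOFF «g26 NEXT MOVE: depth-one lower count is free»):
* §1 `ShaCores.natCard_shaPrimary_rat_dvd_baseChange_of_rank_le_one` — for ANY `E/ℚ`, `K/ℚ` quadratic with `E(K)[2] = 0`,
  `rank E(K) ≤ 1` and `Ш(E/ℚ)` finite: **`#Ш(E/ℚ)[2^∞] ∣ #Ш(E_K/K)[2^∞]`** (the kernel of `Ш(E/ℚ) → Ш(E_K/K)` has order `≤ 2^(rank E(K)) ≤ 2`,
  gk2-p3 g16 `natCard_ker_shaRestriction_le_two_pow_mordellWeilRank`; both orders are squares — Cassels–Tate over `ℚ` AND over `K`, tree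
  theorems `CasselsTateNumberField.isSquare_natCard_primaryComponent_sha`, the infinite case over `K` reading `∣ 0`; gk2-p3's
  `natCard_dvd_of_natCard_ker_le_two`).  = gk2-p3's `natCard_primaryComponent_sha_dvd_baseChange_of_kolyvagin_of_casselsTate` with its three
  named facts REMOVED (`kolyvagin` replaced by the displayed `rank E(K) ≤ 1`, the two Cassels–Tate facts by the tree theorems).
  Hence `pow_dvd_natCard_shaPrimary_baseChange_of_dvd_rat`: **`2^(2m) ∣ #Ш(E/ℚ)[2^∞] ⟹ 2^(2m) ∣ #Ш(E_K/K)[2^∞]`**.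
* §2 `ShaCores.natCard_shaTorsionBy_two_rat_eq_four_of_selmer` / `four_dvd_natCard_shaPrimary_rat_of_selmer` — `rank E(ℚ) = 0`, `ρ̄_{E,2}` onto,
  `#Sel₂(E/ℚ) = 4` ⟹ `#Ш(E/ℚ)[2] = 4` and `4 ∣ #Ш(E/ℚ)[2^∞]` (exact descent count, gk2-p5 `natCard_selmerGroup_two_pow_eq_natCard_shaTorsionBy`).
* §3 LINE 27: `SocleSelection.lowerCountNPhFree_of_natCard_sha_rat` — STUB S6L's binders VERBATIM + ONE hypothesis `2^(2M₀) ∣ #Ш(E/ℚ)[2^∞]`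
  ⟹ S6L's conclusion: **the bet S6L is purely ℚ-SIDE** (= the K₄⁺ Ш-cardinality currency `#Ш(E/ℚ)[2^∞] = 4^(M₀)`, LEAD-BRIEF-g24 §2, off the
  cut); `SocleSelection.lowerCountNPhFree_of_depth_le_one` — S6L's binders VERBATIM + `M₀ ≤ 1` ⟹ S6L's conclusion, UNCONDITIONALLY mod print
  (**S6L at depth one is free**; (HL), the sharp exponent, the primitivity witness and Q2 are idle there).
* §4 LINE 28: the same two theorems on N6's binders VERBATIM (`Δ < 0`, budget `ord₂ C(Wd) ≤ 1`, `FrobEqFrobInfty` witness).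
Frame inputs (`E(K)[2] = 0`, `rank E(K) ≤ 1`) from gk2-p3's sign-free `PlusDescent.exists_frame_of_cut` (inputs: `ρ̄_{E,2}` onto, `w(E) = +1`,
`rank E(ℚ) = 0` — print `MultPublishedInputsAtTwo` at `r_an = 0` —, the `2`-Selmer-minimal twin); NO cut, NO Q2, NO Cassels–Tate item beyond the tree's.
BSD is NOT proved by any of this; after this file the beyond-print content of S6L / N6 is «`4^(M₀) ∣ #Ш(E/ℚ)[2^∞]` at `M₀ ≥ 2`» = K₄⁺ / K₄.

References: [Kramer1981] proof of Thm. 2; [Darmon2004] §3.9, Exercise 3.18; [Cassels1962ArithmeticIV] §1; [SilvermanAEC2009] Thm. X.4.2 (a),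
X.4.14; [GrossLMS1991] §5 Prop. 5.3; [McCallumLMS1991] §5.
-/

set_option autoImplicit false
set_option linter.dupNamespace false -- `Summit.<P>.<Sub>` repeats `BirchSwinnertonDyer` (D-0017)

noncomputable section

open scoped Classical NumberField
open scoped AddSubgroup

namespace Summit.BirchSwinnertonDyer.BirchSwinnertonDyer.Theorems.GenusExact.ShaCores

open WeierstrassCurve NumberField IsDedekindDomain Field AddSubgroup Literature.NumberTheory.EllipticCurves
  Literature.NumberTheory.GaloisRepresentations
open Summit.BirchSwinnertonDyer.BirchSwinnertonDyer.Theorems.GenusExact.PlusDescent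

variable (W : WeierstrassCurve ℚ) [W.IsElliptic] (K : Type) [Field K] [NumberField K]

/-! ## §1 The lower count transfer `#Ш(E/ℚ)[2^∞] ∣ #Ш(E_K/K)[2^∞]` on a quadratic field with `rank E(K) ≤ 1` -/

/-- **`#Ш(E/ℚ)[2^∞] ∣ #Ш(E_K/K)[2^∞]`** for an elliptic `E/ℚ` with `Ш(E/ℚ)` finite and a quadratic `K/ℚ` with `E(K)[2] = 0` and
`rank E(K) ≤ 1` (if `Ш(E_K/K)[2^∞]` is infinite the statement reads `∣ 0`).  The restriction `Ш(E/ℚ)[2^∞] → Ш(E_K/K)[2^∞]` has a kernel of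
order `≤ 2^(rank E(K)) ≤ 2` (Kramer 1981, proof of Thm. 2: the kernel is inflated from `H¹(Gal(K/ℚ), E(K))`; tree
`natCard_ker_shaRestriction_le_two_pow_mordellWeilRank`), and both orders are squares (Cassels–Tate over `ℚ` and over `K`, tree theorems), so the
factor `2` is absorbed (`natCard_dvd_of_natCard_ker_le_two`).  = gk2-p3's `natCard_primaryComponent_sha_dvd_baseChange_of_kolyvagin_of_casselsTate`
with the named facts `kolyvagin`, `exists_casselsTate_pairing` (twice) removed.  UNCONDITIONAL; BSD is not proved by this.
[cite: Kramer1981, proof of Thm. 2] [cite: Darmon2004, Exercise 3.18] [cite: SilvermanAEC2009, Thm. X.4.14] [cite: Cassels1962ArithmeticIV, §1] -/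
theorem natCard_shaPrimary_rat_dvd_baseChange_of_rank_le_one (h2 : Module.finrank ℚ K = 2)
    (hK2 : ∀ P : (W.baseChange K).toAffine.Point, (2 : ℤ) • P = 0 → P = 0)
    (hrk : (W.baseChange K).mordellWeilRank ≤ 1) [Finite W.sha] :
    Nat.card (AddCommGroup.primaryComponent (↥W.sha) 2) ∣ Nat.card (AddCommGroup.primaryComponent (↥(W.baseChange K).sha) 2) := by
  haveI : Fact (Nat.Prime 2) := ⟨Nat.prime_two⟩
  haveI hEK : (W.baseChange K).IsElliptic := inferInstanceAs ((W.map (algebraMap ℚ K)).IsElliptic)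
  haveI : Algebra.IsQuadraticExtension ℚ K := ⟨h2⟩
  haveI : IsGalois ℚ K := inferInstance
  -- squareness over `ℚ` (finite) and over `K` (finite or `Nat.card = 0`)
  have hsqQ : IsSquare (Nat.card (AddCommGroup.primaryComponent (↥W.sha) 2)) :=
    CasselsTateNumberField.isSquare_natCard_primaryComponent_sha W 2
  have hsqK : IsSquare (Nat.card (AddCommGroup.primaryComponent (↥(W.baseChange K).sha) 2)) := by
    rcases finite_or_infinite (AddCommGroup.primaryComponent (↥(W.baseChange K).sha) 2) with hfin | hinf
    · exact CasselsTateNumberField.isSquare_natCard_primaryComponent_sha (W.baseChange K) 2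
    · rw [Nat.card_eq_zero_of_infinite]
      exact ⟨0, rfl⟩
  -- the kernel bound `≤ 2^(rank E(K)) ≤ 2`
  have hK2' : ∀ P : (W.baseChange K).toAffine.Point, 2 • P = 0 → P = 0 := fun P hP ↦
    hK2 P (by rw [← natCast_zsmul] at hP; exact_mod_cast hP)
  have hker : Nat.card (shaRestriction W K).ker ≤ 2 := by
    refine (natCard_ker_shaRestriction_le_two_pow_mordellWeilRank W K h2 hK2').trans ?_
    calc 2 ^ (W.baseChange K).mordellWeilRank ≤ 2 ^ 1 := Nat.pow_le_pow_right (by norm_num) hrk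
      _ = 2 := pow_one 2
  -- the restriction on `2`-primary parts and the count
  set A : AddSubgroup ↥W.sha := AddCommGroup.primaryComponent (↥W.sha) 2 with hAdef
  set B : AddSubgroup ↥(W.baseChange K).sha := AddCommGroup.primaryComponent (↥(W.baseChange K).sha) 2 with hBdef
  have hmem : ∀ a : A, (shaRestriction W K).comp A.subtype a ∈ B := by
    intro a
    obtain ⟨n, hn⟩ := (AddCommGroup.mem_primaryComponent).mp a.2
    rw [hBdef, AddCommGroup.mem_primaryComponent]
    refine ⟨n, ?_⟩
    rw [AddMonoidHom.comp_apply, AddSubgroup.coe_subtype, ← map_nsmul, hn, map_zero]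
  let fA : A →+ B := ((shaRestriction W K).comp A.subtype).codRestrict B hmem
  have hinj : Function.Injective (fun a : fA.ker ↦ (⟨((a : A) : ↥W.sha), by
      have ha : fA (a : A) = 0 := (AddMonoidHom.mem_ker).mp a.2
      have := congrArg (fun b : B ↦ (b : ↥(W.baseChange K).sha)) ha
      exact (AddMonoidHom.mem_ker).mpr this⟩ : (shaRestriction W K).ker)) := by
    intro a a' h
    rw [Subtype.ext_iff] at h
    dsimp only at h
    exact Subtype.ext (Subtype.ext h)
  have hkerA : Nat.card fA.ker ≤ 2 := le_trans (Nat.card_le_card_of_injective _ hinj) hker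
  exact natCard_dvd_of_natCard_ker_le_two fA hkerA hsqQ hsqK

/-- **THE LOWER COUNT TRANSFER K/ℚ: `2^(2m) ∣ #Ш(E/ℚ)[2^∞] ⟹ 2^(2m) ∣ #Ш(E_K/K)[2^∞]`** (`E/ℚ` elliptic with `Ш(E/ℚ)` finite, `K/ℚ`
quadratic with `E(K)[2] = 0` and `rank E(K) ≤ 1`) — the twin of LEAD gk2-p1 g24's `SocleSelection.upperCountTransfer`; in fact any
`d ∣ #Ш(E/ℚ)[2^∞]` transfers.  UNCONDITIONAL; BSD is not proved by this.
[cite: Kramer1981, proof of Thm. 2] [cite: SilvermanAEC2009, Thm. X.4.14] -/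
theorem pow_dvd_natCard_shaPrimary_baseChange_of_dvd_rat (h2 : Module.finrank ℚ K = 2)
    (hK2 : ∀ P : (W.baseChange K).toAffine.Point, (2 : ℤ) • P = 0 → P = 0)
    (hrk : (W.baseChange K).mordellWeilRank ≤ 1) [Finite W.sha] {d : ℕ}
    (hd : d ∣ Nat.card (AddCommGroup.primaryComponent (↥W.sha) 2)) :
    d ∣ Nat.card (AddCommGroup.primaryComponent (↥(W.baseChange K).sha) 2) :=
  hd.trans (natCard_shaPrimary_rat_dvd_baseChange_of_rank_le_one W K h2 hK2 hrk)

/-! ## §2 Depth one over `ℚ`: `#Ш(E/ℚ)[2] = #Sel₂(E/ℚ) = 4` and `4 ∣ #Ш(E/ℚ)[2^∞]` -/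

/-- **`#Ш(E/ℚ)[2] = 4` on a rank-`0` curve with `ρ̄_{E,2}` onto and `#Sel₂(E/ℚ) = 4`**: `E(ℚ)[2] = 0` (big image), so the exact descent count
`#Sel₂ = 2^rank · #E(ℚ)[2] · #Ш[2]` (AEC X.4.2 (a); gk2-p5 `natCard_selmerGroup_two_pow_eq_natCard_shaTorsionBy`) reads `4 = #Ш(E/ℚ)[2]`.
No finiteness needed.  [cite: SilvermanAEC2009, Thm. X.4.2 (a)] -/
theorem natCard_shaTorsionBy_two_rat_eq_four_of_selmer (hs2 : W.HasSurjectiveModNGaloisRep 2) (hrk0 : W.mordellWeilRank = 0)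
    (h4 : Nat.card (W.selmerGroup 2) = 4) :
    Nat.card (AddSubgroup.torsionBy (↥W.sha) ((2 : ℕ) : ℤ)) = 4 := by
  -- `E(ℚ)[2] = 0` (`convert` bridges the decidable-equality instance on `E(ℚ)` used by the general-`F` lemmas)
  have h2t := forall_eq_zero_of_two_zsmul_eq_zero_of_natCard_torsionBy_two_eq_one W
    (by convert natCard_torsionBy_point_two_eq_one_of_hasSurjectiveModNGaloisRep_two W hs2)
  have h := natCard_selmerGroup_two_pow_eq_natCard_shaTorsionBy W hrk0 h2t 1
  simp only [pow_one] at h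
  rw [← h]
  exact h4

/-- **`4 ∣ #Ш(E/ℚ)[2^∞]` on a rank-`0` curve with `ρ̄_{E,2}` onto and `#Sel₂(E/ℚ) = 4`** (`Ш(E/ℚ)[2] ≤ Ш(E/ℚ)[2^∞]`, Lagrange; the infinite
case reads `∣ 0`).  [cite: SilvermanAEC2009, Thm. X.4.2 (a)] -/
theorem four_dvd_natCard_shaPrimary_rat_of_selmer (hs2 : W.HasSurjectiveModNGaloisRep 2) (hrk0 : W.mordellWeilRank = 0)
    (h4 : Nat.card (W.selmerGroup 2) = 4) :
    4 ∣ Nat.card (AddCommGroup.primaryComponent (↥W.sha) 2) := by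
  have hle : AddSubgroup.torsionBy (↥W.sha) ((2 : ℕ) : ℤ) ≤ AddCommGroup.primaryComponent (↥W.sha) 2 := fun z hz ↦
    (AddCommGroup.mem_primaryComponent).mpr ⟨1, by rw [pow_one]; exact AddSubgroup.torsionBy.nsmul_iff.mp hz⟩
  rw [← natCard_shaTorsionBy_two_rat_eq_four_of_selmer W hs2 hrk0 h4]
  exact AddSubgroup.card_dvd_of_le hle

/-- **THE DEPTH-ONE LOWER COUNT `4 ∣ #Ш(E_K/K)[2^∞]`** (`E/ℚ` of rank `0` with `ρ̄_{E,2}` onto, `#Sel₂(E/ℚ) = 4`, `Ш(E/ℚ)` finite; `K/ℚ`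
quadratic with `E(K)[2] = 0`, `rank E(K) ≤ 1`): §2 transferred by §1.  UNCONDITIONAL; BSD is not proved by this.
[cite: Kramer1981, proof of Thm. 2] [cite: SilvermanAEC2009, Thm. X.4.2 (a), X.4.14] -/
theorem four_dvd_natCard_shaPrimary_baseChange_of_selmer (h2 : Module.finrank ℚ K = 2)
    (hK2 : ∀ P : (W.baseChange K).toAffine.Point, (2 : ℤ) • P = 0 → P = 0)
    (hrk : (W.baseChange K).mordellWeilRank ≤ 1) [Finite W.sha]
    (hs2 : W.HasSurjectiveModNGaloisRep 2) (hrk0 : W.mordellWeilRank = 0) (h4 : Nat.card (W.selmerGroup 2) = 4) :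
    4 ∣ Nat.card (AddCommGroup.primaryComponent (↥(W.baseChange K).sha) 2) :=
  pow_dvd_natCard_shaPrimary_baseChange_of_dvd_rat W K h2 hK2 hrk (four_dvd_natCard_shaPrimary_rat_of_selmer W hs2 hrk0 h4)

end Summit.BirchSwinnertonDyer.BirchSwinnertonDyer.Theorems.GenusExact.ShaCores

/-! ## §3 LINE 27 «socle_selection»: STUB S6L reduced to its ℚ-side, and S6L at depth `≤ 1` -/

namespace Summit.BirchSwinnertonDyer.BirchSwinnertonDyer.Theorems.GenusExact.PlusDescent.SocleSelection

open WeierstrassCurve NumberField IsDedekindDomain Field Literature.NumberTheory.EllipticCurves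
  Literature.NumberTheory.GaloisRepresentations Literature.NumberTheory.EllipticCurves.ModularForms AddSubgroup
open Summit.BirchSwinnertonDyer.BirchSwinnertonDyer.Theses.GenusKolyvaginAtTwo (MultPublishedInputsAtTwo)
open Summit.BirchSwinnertonDyer.BirchSwinnertonDyer.Theorems.GenusExact.ShaCores
  (pow_dvd_natCard_shaPrimary_baseChange_of_dvd_rat four_dvd_natCard_shaPrimary_baseChange_of_selmer)

/-- **LINE 27 STUB S6L `stub_lowerCountNPhFree` IS ℚ-SIDE.**  S6L's `∀`-binders VERBATIM (v1.8; the stub's leading `(hQ2 : KolyvaginRelationAtTwo)` is idle here and dropped) followed by ONE hypothesis, the ℚ-side count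
`2^(2M₀) ∣ #Ш(E/ℚ)[2^∞]`, give S6L's conclusion `2^(2M₀) ∣ #Ш(E_K/K)[2^∞]`: the lower count TRANSFERS (§1) on the shallow frame (`E(K)[2] = 0`,
`rank E(K) ≤ 1` from `exists_frame_of_cut`; `rank E(ℚ) = 0` and `Ш(E/ℚ)` finite from `MultPublishedInputsAtTwo` at `r_an = 0`).  Q2, (HL), the sharp
exponent, the primitivity witness, `¬CM`, the signs and budgets are IDLE.  So the bet S6L is exactly «`4^(M₀) ∣ #Ш(E/ℚ)[2^∞]`» = the K₄⁺
Ш-cardinality currency (LEAD-BRIEF-g24 §2) OFF the cut.  BSD is NOT proved by this; S6L is NOT proved by this.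
[cite: Kramer1981, proof of Thm. 2] [cite: SilvermanAEC2009, Thm. X.4.14] [cite: GrossLMS1991, §5 Prop. 5.3] -/
theorem lowerCountNPhFree_of_natCard_sha_rat :
    ∀ (W : WeierstrassCurve ℚ) [W.IsElliptic] [W.IsGloballyMinimal] [NeZero (W.conductorNorm ℤ)],
      ¬ W.HasCM → W.analyticRank = 0 → (∀ n : ℕ, 0 < n → W.HasSurjectiveModNGaloisRep ((2 : ℤ) ^ n)) → Odd W.tamagawaProduct → 0 < W.Δ →
      ∀ (K : Type) [Field K] [NumberField K], IsImaginaryQuadratic K → Odd (NumberField.discr K) → NumberField.discr K ≠ -3 →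
        SatisfiesHeegnerHypothesis (W.conductorNorm ℤ) K →
        ¬ IsSquare ((NumberField.discr K : ℚ) * -|W.Δ|) → ¬ IsSquare ((NumberField.discr K : ℚ) * (-(2 * |W.Δ|))) →
      ∀ (Dt : ModularParametrizationData W (W.conductorNorm ℤ)),
        (∀ z ∈ Dt.L.lattice, ∃ w ∈ periodLattice Dt.f, z = (Dt.c : ℂ) * w) → Odd Dt.c →
      ∀ (β : ℤ) (ι : K →+* ℂ) (d₁ : KolyvaginHeegnerData Dt β ι 1), ¬ IsOfFinAddOrder d₁.derivedPoint →
      ∀ (M₀ : ℕ), (∃ Q : (W.baseChange (ringClassField K ι 1)).toAffine.Point, ((2 ^ M₀ : ℕ) : ℤ) • Q = d₁.derivedPoint) →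
        (¬ ∃ Q : (W.baseChange (ringClassField K ι 1)).toAffine.Point, ((2 ^ (M₀ + 1) : ℕ) : ℤ) • Q = d₁.derivedPoint) →
        W.rootNumber = 1 →
      ∀ (Wd : WeierstrassCurve ℚ) [Wd.IsElliptic] [Wd.IsGloballyMinimal],
        (∃ C : WeierstrassCurve.VariableChange ℚ, C • W.quadraticTwist (NumberField.discr K : ℚ) = Wd) →
        Wd.analyticRank = 1 → Nat.card (Wd.selmerGroup 2) = 2 → padicValNat 2 Wd.tamagawaProduct = 0 →
      MultPublishedInputsAtTwo →
      -- (HL)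
      (∀ (M : ℕ) (hdvd : ((2 ^ M : ℕ) : ℤ) ∣ ((2 ^ (M + 1) : ℕ) : ℤ)) (c : ℤ),
          (∀ ρ ∈ torsionFixing (W.baseChange K) ((2 ^ (M + 1) : ℕ) : ℤ), h1Eval (W.baseChange K) ((2 ^ (M + 1) : ℕ) : ℤ)
              (c • torsionH1OfDvd (W.baseChange K) hdvd (d₁.kolyvaginClass Nat.prime_two M)) ρ = 0) →
          c • torsionH1OfDvd (W.baseChange K) hdvd (d₁.kolyvaginClass Nat.prime_two M) = 0) →
      -- the ℚ-side sharp exponent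
      (∀ (M : ℕ) (s₀ : galH1Torsion W ((2 ^ M : ℕ) : ℤ)), s₀ ∈ selmerGroup W ((2 ^ M : ℕ) : ℤ) → ((2 ^ M₀ : ℕ) : ℤ) • s₀ = 0) →
      -- the primitivity witness of `hP`
      ∀ (n : ℕ) (d : KolyvaginHeegnerData Dt β ι n), Squarefree n →
        (∀ ℓ ∈ n.primeFactors, Zhang2014.IsKolyvaginPrime (W.conductorNorm ℤ) W K 2 ℓ ∧ 2 ≤ Zhang2014.kolyvaginIndex W 2 ℓ ∧
          ∃ (v : HeightOneSpectrum (𝓞 ℚ)) (𝔓 : Ideal (Literature.NumberTheory.GaloisRepresentations.absIntegers (𝓞 ℚ) ℚ))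
            (h : Field.absoluteGaloisGroup ℚ), ((ℓ : ℕ) : 𝓞 ℚ) ∈ v.asIdeal ∧ 𝔓 ∈ v.primesAbove ∧ IsArithFrobAt (𝓞 ℚ) h 𝔓 ∧
            ∃ u : W.geomTorsion ((2 : ℕ) : ℤ), h • u ≠ u) →
        (¬ ∃ Q : (W.baseChange (ringClassField K ι n)).toAffine.Point, (2 : ℤ) • Q = d.derivedPoint) →
      2 ^ (2 * M₀) ∣ Nat.card (AddCommGroup.primaryComponent W.sha 2) →
      2 ^ (2 * M₀) ∣ Nat.card (AddCommGroup.primaryComponent (W.baseChange K).sha 2) := by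
  intro W _ _ _ _hcm hr0 hρ _hT _hsgn K _ _ hIQ _hodd _h3 hHe _hsq1 _hsq2 Dt _hopt _hc β ι d₁ hy M₀ _hdiv hndiv hw Wd _ _ hWd _hrd hSel
    _hTam hGZK _hHL _hsharp n d _hn _hKoly _hPn hcount
  haveI : Fact (Nat.Prime 2) := ⟨Nat.prime_two⟩
  have hs2 : W.HasSurjectiveModNGaloisRep 2 := by simpa using hρ 1 one_pos
  -- print: `rank E(ℚ) = r_an(E) = 0` and `Ш(E/ℚ)` finite
  have hle : W.analyticRank ≤ 1 := by rw [hr0]; exact zero_le_one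
  have hrk0 : W.mordellWeilRank = 0 := by rw [(hGZK W hle).1, hr0]
  haveI : Finite W.sha := (hGZK W hle).2
  -- the frame: `E(K)[2] = 0`, `rank E(K) ≤ 1` (gk2-p3's sign-free `exists_frame_of_cut`; no cut is used)
  obtain ⟨τ, hτ, -⟩ := exists_conj_of_isImaginaryQuadratic (K := K) hIQ
  obtain ⟨h2tors, hrk1, -, -⟩ := exists_frame_of_cut W K hIQ hHe hs2 hτ Dt β ι d₁ hy M₀ hndiv hw hrk0 Wd hWd hSel
  exact pow_dvd_natCard_shaPrimary_baseChange_of_dvd_rat W K hIQ.1 h2tors hrk1 hcount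

/-- **LINE 27 STUB S6L AT DEPTH `≤ 1` — PROVED** (pen bsd-idea-1 g25 HANDOFF «depth-one lower count is free»).  S6L's `∀`-binders VERBATIM
(v1.8, `hQ2` dropped) followed by the cell clause `#Sel₂(E/ℚ) = 4` (in scope in `OffCutResidualAtTwoR_of` as `h4`) and `M₀ ≤ 1` give S6L's conclusion: at `M₀ = 0`
trivially, at `M₀ = 1` because `#Ш(E/ℚ)[2] = #Sel₂(E/ℚ) = 4` (rank `0`, `E(ℚ)[2] = 0`) so `4 ∣ #Ш(E/ℚ)[2^∞] ∣ #Ш(E_K/K)[2^∞]` (§1–§2).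
UNCONDITIONAL modulo the displayed print item; Q2, (HL), the sharp exponent and the primitivity witness are IDLE.  Reshape for the pen: S6L :=
«`2 ≤ M₀` ⟹ lower count» (the bet), the case `M₀ ≤ 1` closed by `exact …SocleSelection.lowerCountNPhFree_of_depth_le_one W … hPn h4 hM₀`.
BSD is NOT proved by this; S6L at depth `≥ 2` is NOT proved by this.  [cite: Kramer1981, proof of Thm. 2] [cite: SilvermanAEC2009, Thm. X.4.2 (a), X.4.14] -/
theorem lowerCountNPhFree_of_depth_le_one :
    ∀ (W : WeierstrassCurve ℚ) [W.IsElliptic] [W.IsGloballyMinimal] [NeZero (W.conductorNorm ℤ)],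
      ¬ W.HasCM → W.analyticRank = 0 → (∀ n : ℕ, 0 < n → W.HasSurjectiveModNGaloisRep ((2 : ℤ) ^ n)) → Odd W.tamagawaProduct → 0 < W.Δ →
      ∀ (K : Type) [Field K] [NumberField K], IsImaginaryQuadratic K → Odd (NumberField.discr K) → NumberField.discr K ≠ -3 →
        SatisfiesHeegnerHypothesis (W.conductorNorm ℤ) K →
        ¬ IsSquare ((NumberField.discr K : ℚ) * -|W.Δ|) → ¬ IsSquare ((NumberField.discr K : ℚ) * (-(2 * |W.Δ|))) →
      ∀ (Dt : ModularParametrizationData W (W.conductorNorm ℤ)),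
        (∀ z ∈ Dt.L.lattice, ∃ w ∈ periodLattice Dt.f, z = (Dt.c : ℂ) * w) → Odd Dt.c →
      ∀ (β : ℤ) (ι : K →+* ℂ) (d₁ : KolyvaginHeegnerData Dt β ι 1), ¬ IsOfFinAddOrder d₁.derivedPoint →
      ∀ (M₀ : ℕ), (∃ Q : (W.baseChange (ringClassField K ι 1)).toAffine.Point, ((2 ^ M₀ : ℕ) : ℤ) • Q = d₁.derivedPoint) →
        (¬ ∃ Q : (W.baseChange (ringClassField K ι 1)).toAffine.Point, ((2 ^ (M₀ + 1) : ℕ) : ℤ) • Q = d₁.derivedPoint) →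
        W.rootNumber = 1 →
      ∀ (Wd : WeierstrassCurve ℚ) [Wd.IsElliptic] [Wd.IsGloballyMinimal],
        (∃ C : WeierstrassCurve.VariableChange ℚ, C • W.quadraticTwist (NumberField.discr K : ℚ) = Wd) →
        Wd.analyticRank = 1 → Nat.card (Wd.selmerGroup 2) = 2 → padicValNat 2 Wd.tamagawaProduct = 0 →
      MultPublishedInputsAtTwo →
      -- (HL)
      (∀ (M : ℕ) (hdvd : ((2 ^ M : ℕ) : ℤ) ∣ ((2 ^ (M + 1) : ℕ) : ℤ)) (c : ℤ),
          (∀ ρ ∈ torsionFixing (W.baseChange K) ((2 ^ (M + 1) : ℕ) : ℤ), h1Eval (W.baseChange K) ((2 ^ (M + 1) : ℕ) : ℤ)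
              (c • torsionH1OfDvd (W.baseChange K) hdvd (d₁.kolyvaginClass Nat.prime_two M)) ρ = 0) →
          c • torsionH1OfDvd (W.baseChange K) hdvd (d₁.kolyvaginClass Nat.prime_two M) = 0) →
      -- the ℚ-side sharp exponent
      (∀ (M : ℕ) (s₀ : galH1Torsion W ((2 ^ M : ℕ) : ℤ)), s₀ ∈ selmerGroup W ((2 ^ M : ℕ) : ℤ) → ((2 ^ M₀ : ℕ) : ℤ) • s₀ = 0) →
      -- the primitivity witness of `hP`
      ∀ (n : ℕ) (d : KolyvaginHeegnerData Dt β ι n), Squarefree n →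
        (∀ ℓ ∈ n.primeFactors, Zhang2014.IsKolyvaginPrime (W.conductorNorm ℤ) W K 2 ℓ ∧ 2 ≤ Zhang2014.kolyvaginIndex W 2 ℓ ∧
          ∃ (v : HeightOneSpectrum (𝓞 ℚ)) (𝔓 : Ideal (Literature.NumberTheory.GaloisRepresentations.absIntegers (𝓞 ℚ) ℚ))
            (h : Field.absoluteGaloisGroup ℚ), ((ℓ : ℕ) : 𝓞 ℚ) ∈ v.asIdeal ∧ 𝔓 ∈ v.primesAbove ∧ IsArithFrobAt (𝓞 ℚ) h 𝔓 ∧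
            ∃ u : W.geomTorsion ((2 : ℕ) : ℤ), h • u ≠ u) →
        (¬ ∃ Q : (W.baseChange (ringClassField K ι n)).toAffine.Point, (2 : ℤ) • Q = d.derivedPoint) →
      Nat.card (W.selmerGroup 2) = 4 → M₀ ≤ 1 →
      2 ^ (2 * M₀) ∣ Nat.card (AddCommGroup.primaryComponent (W.baseChange K).sha 2) := by
  intro W _ _ _ _hcm hr0 hρ _hT _hsgn K _ _ hIQ _hodd _h3 hHe _hsq1 _hsq2 Dt _hopt _hc β ι d₁ hy M₀ _hdiv hndiv hw Wd _ _ hWd _hrd hSel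
    _hTam hGZK _hHL _hsharp n d _hn _hKoly _hPn h4 hM₀
  haveI : Fact (Nat.Prime 2) := ⟨Nat.prime_two⟩
  have hs2 : W.HasSurjectiveModNGaloisRep 2 := by simpa using hρ 1 one_pos
  -- print: `rank E(ℚ) = r_an(E) = 0` and `Ш(E/ℚ)` finite
  have hle : W.analyticRank ≤ 1 := by rw [hr0]; exact zero_le_one
  have hrk0 : W.mordellWeilRank = 0 := by rw [(hGZK W hle).1, hr0]
  haveI : Finite W.sha := (hGZK W hle).2
  -- the frame: `E(K)[2] = 0`, `rank E(K) ≤ 1` (gk2-p3's sign-free `exists_frame_of_cut`; no cut is used)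
  obtain ⟨τ, hτ, -⟩ := exists_conj_of_isImaginaryQuadratic (K := K) hIQ
  obtain ⟨h2tors, hrk1, -, -⟩ := exists_frame_of_cut W K hIQ hHe hs2 hτ Dt β ι d₁ hy M₀ hndiv hw hrk0 Wd hWd hSel
  rcases Nat.lt_or_ge M₀ 1 with hlt | hge
  · have h0 : M₀ = 0 := by omega
    subst h0
    simp
  · have h1 : M₀ = 1 := le_antisymm hM₀ hge
    subst h1
    simpa using four_dvd_natCard_shaPrimary_baseChange_of_selmer W K hIQ.1 h2tors hrk1 hs2 hrk0 h4

end Summit.BirchSwinnertonDyer.BirchSwinnertonDyer.Theorems.GenusExact.PlusDescent.SocleSelection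

/-! ## §4 LINE 28 «visible_deep_socle»: STUB N6 reduced to its ℚ-side, and N6 at depth `≤ 1` -/

namespace Summit.BirchSwinnertonDyer.BirchSwinnertonDyer.Theorems.GenusExact.PlusDescent.SocleSelection

open WeierstrassCurve NumberField IsDedekindDomain Field Literature.NumberTheory.EllipticCurves
  Literature.NumberTheory.GaloisRepresentations Literature.NumberTheory.EllipticCurves.ModularForms AddSubgroup
open Summit.BirchSwinnertonDyer.BirchSwinnertonDyer.Theses.GenusKolyvaginAtTwo (MultPublishedInputsAtTwo)
open Summit.BirchSwinnertonDyer.BirchSwinnertonDyer.Theorems.GenusExact.ShaCores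
  (pow_dvd_natCard_shaPrimary_baseChange_of_dvd_rat four_dvd_natCard_shaPrimary_baseChange_of_selmer)

/-- **LINE 28 STUB N6 `stub_lowerCount` IS ℚ-SIDE.**  N6's `∀`-binders VERBATIM (v1.9: `Δ < 0`, budget `ord₂ C(Wd) ≤ 1`, `FrobEqFrobInfty` witness;
`hQ2` dropped) followed by the ℚ-side count `2^(2M₀) ∣ #Ш(E/ℚ)[2^∞]` give N6's conclusion `2^(2M₀) ∣ #Ш(E_K/K)[2^∞]` (§1 on the deep frame; `exists_frame_of_cut` is
sign-free).  Q2, (HL), the sharp exponent, the witness and the budget are IDLE.  BSD is NOT proved by this; N6 is NOT proved by this.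
[cite: Kramer1981, proof of Thm. 2] [cite: SilvermanAEC2009, Thm. X.4.14] [cite: GrossLMS1991, §5 Prop. 5.3] -/
theorem lowerCount_negDisc_of_natCard_sha_rat :
    ∀ (W : WeierstrassCurve ℚ) [W.IsElliptic] [W.IsGloballyMinimal] [NeZero (W.conductorNorm ℤ)],
      ¬ W.HasCM → W.analyticRank = 0 → (∀ n : ℕ, 0 < n → W.HasSurjectiveModNGaloisRep ((2 : ℤ) ^ n)) → Odd W.tamagawaProduct → W.Δ < 0 →
      ∀ (K : Type) [Field K] [NumberField K], IsImaginaryQuadratic K → Odd (NumberField.discr K) → NumberField.discr K ≠ -3 →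
        SatisfiesHeegnerHypothesis (W.conductorNorm ℤ) K →
        ¬ IsSquare ((NumberField.discr K : ℚ) * -|W.Δ|) → ¬ IsSquare ((NumberField.discr K : ℚ) * (-(2 * |W.Δ|))) →
      ∀ (Dt : ModularParametrizationData W (W.conductorNorm ℤ)),
        (∀ z ∈ Dt.L.lattice, ∃ w ∈ periodLattice Dt.f, z = (Dt.c : ℂ) * w) → Odd Dt.c →
      ∀ (β : ℤ) (ι : K →+* ℂ) (d₁ : KolyvaginHeegnerData Dt β ι 1), ¬ IsOfFinAddOrder d₁.derivedPoint →
      ∀ (M₀ : ℕ), (∃ Q : (W.baseChange (ringClassField K ι 1)).toAffine.Point, ((2 ^ M₀ : ℕ) : ℤ) • Q = d₁.derivedPoint) →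
        (¬ ∃ Q : (W.baseChange (ringClassField K ι 1)).toAffine.Point, ((2 ^ (M₀ + 1) : ℕ) : ℤ) • Q = d₁.derivedPoint) →
        W.rootNumber = 1 →
      ∀ (Wd : WeierstrassCurve ℚ) [Wd.IsElliptic] [Wd.IsGloballyMinimal],
        (∃ C : WeierstrassCurve.VariableChange ℚ, C • W.quadraticTwist (NumberField.discr K : ℚ) = Wd) →
        Wd.analyticRank = 1 → Nat.card (Wd.selmerGroup 2) = 2 → padicValNat 2 Wd.tamagawaProduct ≤ 1 →
      MultPublishedInputsAtTwo →
      -- (HL)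
      (∀ (M : ℕ) (hdvd : ((2 ^ M : ℕ) : ℤ) ∣ ((2 ^ (M + 1) : ℕ) : ℤ)) (c : ℤ),
          (∀ ρ ∈ torsionFixing (W.baseChange K) ((2 ^ (M + 1) : ℕ) : ℤ), h1Eval (W.baseChange K) ((2 ^ (M + 1) : ℕ) : ℤ)
              (c • torsionH1OfDvd (W.baseChange K) hdvd (d₁.kolyvaginClass Nat.prime_two M)) ρ = 0) →
          c • torsionH1OfDvd (W.baseChange K) hdvd (d₁.kolyvaginClass Nat.prime_two M) = 0) →
      -- the ℚ-side sharp exponent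
      (∀ (M : ℕ) (s₀ : galH1Torsion W ((2 ^ M : ℕ) : ℤ)), s₀ ∈ selmerGroup W ((2 ^ M : ℕ) : ℤ) → ((2 ^ M₀ : ℕ) : ℤ) • s₀ = 0) →
      -- the primitivity witness of N1
      ∀ (n : ℕ) (d : KolyvaginHeegnerData Dt β ι n), Squarefree n →
        (∀ ℓ ∈ n.primeFactors, Zhang2014.IsKolyvaginPrime (W.conductorNorm ℤ) W K 2 ℓ ∧ 2 ≤ Zhang2014.kolyvaginIndex W 2 ℓ ∧
          FrobEqFrobInfty W K 2 ℓ) →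
        (¬ ∃ Q : (W.baseChange (ringClassField K ι n)).toAffine.Point, (2 : ℤ) • Q = d.derivedPoint) →
      2 ^ (2 * M₀) ∣ Nat.card (AddCommGroup.primaryComponent W.sha 2) →
      2 ^ (2 * M₀) ∣ Nat.card (AddCommGroup.primaryComponent (W.baseChange K).sha 2) := by
  intro W _ _ _ _hcm hr0 hρ _hT _hsgn K _ _ hIQ _hodd _h3 hHe _hsq1 _hsq2 Dt _hopt _hc β ι d₁ hy M₀ _hdiv hndiv hw Wd _ _ hWd _hrd hSel
    _hTam hGZK _hHL _hsharp n d _hn _hKoly _hPn hcount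
  haveI : Fact (Nat.Prime 2) := ⟨Nat.prime_two⟩
  have hs2 : W.HasSurjectiveModNGaloisRep 2 := by simpa using hρ 1 one_pos
  -- print: `rank E(ℚ) = r_an(E) = 0` and `Ш(E/ℚ)` finite
  have hle : W.analyticRank ≤ 1 := by rw [hr0]; exact zero_le_one
  have hrk0 : W.mordellWeilRank = 0 := by rw [(hGZK W hle).1, hr0]
  haveI : Finite W.sha := (hGZK W hle).2
  -- the frame: `E(K)[2] = 0`, `rank E(K) ≤ 1` (gk2-p3's sign-free `exists_frame_of_cut`; no cut is used)
  obtain ⟨τ, hτ, -⟩ := exists_conj_of_isImaginaryQuadratic (K := K) hIQ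
  obtain ⟨h2tors, hrk1, -, -⟩ := exists_frame_of_cut W K hIQ hHe hs2 hτ Dt β ι d₁ hy M₀ hndiv hw hrk0 Wd hWd hSel
  exact pow_dvd_natCard_shaPrimary_baseChange_of_dvd_rat W K hIQ.1 h2tors hrk1 hcount

/-- **LINE 28 STUB N6 AT DEPTH `≤ 1` — PROVED.**  N6's `∀`-binders VERBATIM (v1.9, `hQ2` dropped) followed by `#Sel₂(E/ℚ) = 4` (in scope in LINE 28's
`OffCutResidualAtTwoR_of` as `h4`) and `M₀ ≤ 1` give N6's conclusion (§1–§2 on the deep frame).  Reshape for the pen: N6 := «`2 ≤ M₀` ⟹ lower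
count», the case `M₀ ≤ 1` closed by `exact …SocleSelection.lowerCount_negDisc_of_depth_le_one W … hPn h4 hM₀`.  BSD is NOT proved by this;
N6 at depth `≥ 2` is NOT proved by this.  [cite: Kramer1981, proof of Thm. 2] [cite: SilvermanAEC2009, Thm. X.4.2 (a), X.4.14] -/
theorem lowerCount_negDisc_of_depth_le_one :
    ∀ (W : WeierstrassCurve ℚ) [W.IsElliptic] [W.IsGloballyMinimal] [NeZero (W.conductorNorm ℤ)],
      ¬ W.HasCM → W.analyticRank = 0 → (∀ n : ℕ, 0 < n → W.HasSurjectiveModNGaloisRep ((2 : ℤ) ^ n)) → Odd W.tamagawaProduct → W.Δ < 0 →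
      ∀ (K : Type) [Field K] [NumberField K], IsImaginaryQuadratic K → Odd (NumberField.discr K) → NumberField.discr K ≠ -3 →
        SatisfiesHeegnerHypothesis (W.conductorNorm ℤ) K →
        ¬ IsSquare ((NumberField.discr K : ℚ) * -|W.Δ|) → ¬ IsSquare ((NumberField.discr K : ℚ) * (-(2 * |W.Δ|))) →
      ∀ (Dt : ModularParametrizationData W (W.conductorNorm ℤ)),
        (∀ z ∈ Dt.L.lattice, ∃ w ∈ periodLattice Dt.f, z = (Dt.c : ℂ) * w) → Odd Dt.c →
      ∀ (β : ℤ) (ι : K →+* ℂ) (d₁ : KolyvaginHeegnerData Dt β ι 1), ¬ IsOfFinAddOrder d₁.derivedPoint →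
      ∀ (M₀ : ℕ), (∃ Q : (W.baseChange (ringClassField K ι 1)).toAffine.Point, ((2 ^ M₀ : ℕ) : ℤ) • Q = d₁.derivedPoint) →
        (¬ ∃ Q : (W.baseChange (ringClassField K ι 1)).toAffine.Point, ((2 ^ (M₀ + 1) : ℕ) : ℤ) • Q = d₁.derivedPoint) →
        W.rootNumber = 1 →
      ∀ (Wd : WeierstrassCurve ℚ) [Wd.IsElliptic] [Wd.IsGloballyMinimal],
        (∃ C : WeierstrassCurve.VariableChange ℚ, C • W.quadraticTwist (NumberField.discr K : ℚ) = Wd) →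
        Wd.analyticRank = 1 → Nat.card (Wd.selmerGroup 2) = 2 → padicValNat 2 Wd.tamagawaProduct ≤ 1 →
      MultPublishedInputsAtTwo →
      -- (HL)
      (∀ (M : ℕ) (hdvd : ((2 ^ M : ℕ) : ℤ) ∣ ((2 ^ (M + 1) : ℕ) : ℤ)) (c : ℤ),
          (∀ ρ ∈ torsionFixing (W.baseChange K) ((2 ^ (M + 1) : ℕ) : ℤ), h1Eval (W.baseChange K) ((2 ^ (M + 1) : ℕ) : ℤ)
              (c • torsionH1OfDvd (W.baseChange K) hdvd (d₁.kolyvaginClass Nat.prime_two M)) ρ = 0) →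
          c • torsionH1OfDvd (W.baseChange K) hdvd (d₁.kolyvaginClass Nat.prime_two M) = 0) →
      -- the ℚ-side sharp exponent
      (∀ (M : ℕ) (s₀ : galH1Torsion W ((2 ^ M : ℕ) : ℤ)), s₀ ∈ selmerGroup W ((2 ^ M : ℕ) : ℤ) → ((2 ^ M₀ : ℕ) : ℤ) • s₀ = 0) →
      -- the primitivity witness of N1
      ∀ (n : ℕ) (d : KolyvaginHeegnerData Dt β ι n), Squarefree n →
        (∀ ℓ ∈ n.primeFactors, Zhang2014.IsKolyvaginPrime (W.conductorNorm ℤ) W K 2 ℓ ∧ 2 ≤ Zhang2014.kolyvaginIndex W 2 ℓ ∧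
          FrobEqFrobInfty W K 2 ℓ) →
        (¬ ∃ Q : (W.baseChange (ringClassField K ι n)).toAffine.Point, (2 : ℤ) • Q = d.derivedPoint) →
      Nat.card (W.selmerGroup 2) = 4 → M₀ ≤ 1 →
      2 ^ (2 * M₀) ∣ Nat.card (AddCommGroup.primaryComponent (W.baseChange K).sha 2) := by
  intro W _ _ _ _hcm hr0 hρ _hT _hsgn K _ _ hIQ _hodd _h3 hHe _hsq1 _hsq2 Dt _hopt _hc β ι d₁ hy M₀ _hdiv hndiv hw Wd _ _ hWd _hrd hSel
    _hTam hGZK _hHL _hsharp n d _hn _hKoly _hPn h4 hM₀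
  haveI : Fact (Nat.Prime 2) := ⟨Nat.prime_two⟩
  have hs2 : W.HasSurjectiveModNGaloisRep 2 := by simpa using hρ 1 one_pos
  -- print: `rank E(ℚ) = r_an(E) = 0` and `Ш(E/ℚ)` finite
  have hle : W.analyticRank ≤ 1 := by rw [hr0]; exact zero_le_one
  have hrk0 : W.mordellWeilRank = 0 := by rw [(hGZK W hle).1, hr0]
  haveI : Finite W.sha := (hGZK W hle).2
  -- the frame: `E(K)[2] = 0`, `rank E(K) ≤ 1` (gk2-p3's sign-free `exists_frame_of_cut`; no cut is used)
  obtain ⟨τ, hτ, -⟩ := exists_conj_of_isImaginaryQuadratic (K := K) hIQ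
  obtain ⟨h2tors, hrk1, -, -⟩ := exists_frame_of_cut W K hIQ hHe hs2 hτ Dt β ι d₁ hy M₀ hndiv hw hrk0 Wd hWd hSel
  rcases Nat.lt_or_ge M₀ 1 with hlt | hge
  · have h0 : M₀ = 0 := by omega
    subst h0
    simp
  · have h1 : M₀ = 1 := le_antisymm hM₀ hge
    subst h1
    simpa using four_dvd_natCard_shaPrimary_baseChange_of_selmer W K hIQ.1 h2tors hrk1 hs2 hrk0 h4

end Summit.BirchSwinnertonDyer.BirchSwinnertonDyer.Theorems.GenusExact.PlusDescent.SocleSelection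

end
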